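import Summits.Ventures.HodgeRepro2.T5SU11KernelCompositionCorner
import Summits.Ventures.HodgeRepro2.T5SU11KernelDiagonalDerivative

/-!
# The spectral derivative of the diagonal has a finite limit at the origin: `∂_μ K_λ(t, t) → ∫_0^∞ χ_λ² sinh 2r dr` as `t → 0⁺`

Row 621 computed `∂_μ K_λ(t, t) = ∫ K_λ(t, r)² sinh 2r dr = K_λ^{∘2}(t, t)`. Row 603 showed that the diagonal itself blows up at the
origin (`K_λ(t, t) → −∞`); its spectral derivative does not: along the diagonal `(t, t) → (0, 0)`, row 645 gives

* `integral_kernel_sq_eq_kernel_comp_two` — `∫ K_λ(t, r)² sinh 2r dr = ∫ K_λ(t, r) K_λ(r, t) sinh 2r dr`;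
* `tendsto_integral_kernel_sq_nhdsGT_zero` — **`∫ K_λ(t, r)² sinh 2r dr → ∫ χ_λ(r)² sinh 2r dr` as `t → 0⁺`**: the spectral
  derivative of the diagonal extends continuously to the origin, with value the `sinh`-mass of `χ_λ²`.

Nothing is claimed about (N).

Blind lane: Mathlib + the HodgeRepro2 prefix only; no sorry; axioms ⊆ {propext, Classical.choice,
Quot.sound}.
-/

namespace Summit.Ventures.HodgeRepro2.T5SU11KernelDiagonalMuDerivativeOrigin

open Filter Topology MeasureTheory
open Set (Ioi)
open T5SU11Cartan T5SU11SphericalFunction T5SU11SphericalDecay T5SU11RadialGreenKernel T5SU11KernelCompositionCorner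
  T5SU11KernelDiagonalDerivative

section measure

variable [MeasurableSpace Circle] [BorelSpace Circle]

omit [BorelSpace Circle] in
/-- `∫ K_λ(t, r)² sinh 2r dr = ∫ K_λ(t, r) K_λ(r, t) sinh 2r dr` (the symmetry of the kernel). -/
theorem integral_kernel_sq_eq_kernel_comp_two (lam t : ℝ) :
    ∫ r in Ioi 0, sphGreenKernel lam t r ^ 2 * Real.sinh (2 * r)
      = ∫ r in Ioi 0, sphGreenKernel lam t r * sphGreenKernel lam r t * Real.sinh (2 * r) := by
  apply setIntegral_congr_fun measurableSet_Ioi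
  intro r _
  simp only
  rw [sq, sphGreenKernel_symm lam r t]

variable {lam : ℝ} (hlam : 1 < lam)

include hlam in
/-- **`∂_μ K_λ(t, t) = ∫ K_λ(t, r)² sinh 2r dr → ∫ χ_λ(r)² sinh 2r dr` as `t → 0⁺`** (row 621's derivative value along the diagonal,
row 645's corner limit). -/
theorem tendsto_integral_kernel_sq_nhdsGT_zero :
    Tendsto (fun t => ∫ r in Ioi 0, sphGreenKernel lam t r ^ 2 * Real.sinh (2 * r)) (𝓝[>] 0)
      (𝓝 (∫ r in Ioi 0, sphDecay lam r * sphDecay lam r * Real.sinh (2 * r))) := by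
  have hdiag : Tendsto (fun t : ℝ => (t, t)) (𝓝[>] 0) (𝓝[>] 0 ×ˢ 𝓝[>] 0) := tendsto_id.prodMk tendsto_id
  have h := (tendsto_kernel_comp_two_corner hlam).comp hdiag
  refine h.congr fun t => ?_
  simp only [Function.comp]
  exact (integral_kernel_sq_eq_kernel_comp_two lam t).symm

end measure

end Summit.Ventures.HodgeRepro2.T5SU11KernelDiagonalMuDerivativeOrigin
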